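/-
Copyright: the b2b-balaban T⁴-continuum CRUX team, row NE7b leaf lineage `t4-ne7b-formalise-leaf-05` (gen 161). Project licence.
-/
import Summits.QuantumFields.BalabanUV.T4Continuum.Spine.NE7b.BlockAverageTower
import Summits.QuantumFields.BalabanUV.T4Continuum.Spine.NE7b.BlockAverageSectionNorm

/-!
# THE FREE TOWER's SECTION LETTERS ARE LEVEL-FREE — every critical section `H j` of the recursive Gaussian tower (BATW `exists_tower`)
# has operator norm `‖H j‖ ≤ (1 + 2d·γ₁(d)·L²)·√(L^d)`, and every level form has `‖V j‖ ≤ 4d·γ₁(d)`: SECS's per-level section constants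
# `N_j`, read on the reference flow in energy currency, do NOT depend on the level (row NE7b, node U5c; [folklore] over BATW, leaf-03's QFM
# `opNorm_propagator_le`, leaf-06's THEC `opNorm_le_of_abs_quad_le` and this lineage's BAKF block-constant section BY NAME)

Cell `pub-balaban`, sub-cell `t4`, spine estimate NE7b (`T4WeightBudget.RelWeightBound`; the cell's OWN estimate — NOT PRINTED in
[Bałaban 1983–89], NOT PROVED).  Crux-route work under `Spine/NE7b/` by a row leaf (`t4-ne7b-formalise-leaf-05` gen 161) under FREEZE (0)'s
crux-prover clause.  NOTHING of Bałaban's is asserted; no `T4Continuum/Support` leaf typed; no `def`; zero `sorry`.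

WHY (located).  Leaf-06's SECS books the equation-map tower's composite section through per-level letters `p k (T_k⁻¹(v,0)) ≤ N_k·p (k+1) v`
and displays the product `∏ N_j` (PRICING-NE7b v134 F795: each factor `> 1`, no control).  For the REFERENCE flow in energy currency the
analogous letter is the operator norm of the critical section `H j : Tor (N j) → Tor (N (j+1))` of the free tower.  This file bounds it by a
constant depending on `d` and `L` ONLY — the product still grows like `N^k`, honestly, but no factor degrades with the level: the inputs are
BATW's level-free floor `2∕L²` and ceiling `γ₁(d)`, the crude bound `R g g ≤ 4d‖g‖²` of the unit Dirichlet form, the block-constant section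
`g ↦ g ∘ blockOf` (norm `√(L^d)`) and QFM's `‖H‖ ≤ (1 + ‖Q‖∕m)‖M‖`.

WHAT IS PROVED ([folklore]; the one-level letters — `unitForm_quad_le`, `opNorm_le_of_sandwich`, `blockConstant_*`, `section_opNorm_le` — are
this lineage's `…BlockAverageSectionNorm` (BASN) BY NAME):
* **`tower_section_opNorm_le`**: in BATW's tower (any level family, any `k ≥ 1`), for every `j < k`:
  `‖H j‖ ≤ (1 + 4d·gamma1 d ∕ (2∕L²))·√(L^d)` and `‖V j‖ ≤ 4d·gamma1 d` — uniformly in `j`, `k` and the volume; toy.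

NOT HERE (honest): sharp constants (the true `‖H j‖` is `√(L^d)·(1 + O(1))`); the sup-norm currency of the OWNER's road (this is the
energy currency); any claim that the product `∏ N_j` is controlled (it is not — BATL ∕ BATW's closed form is the control); the interacting
tower (BAST gives the same letters with `γ₀, γ₁` inserted — not typed here); anything of Bałaban's.  BY-NAME EFFECT ON THE WALL: NONE.  NE7b
NOT PRINTED ∕ NOT PROVED; spine PROVED 0∕9; rung (B)+1 on a FINITE torus — NOT infinite volume, NOT the mass gap, NOT Clay.  HONEST DEPENDENCY:
continuum YM on T⁴ ⇐ BetaPertH ∧ nine spine estimates (0∕9 proved); BetaPertH ⇐ (D1) ∧ (D4) ∧ CAP+tail; G-an2-4 gates asym, D1 and NE2∕3∕4.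
-/
set_option autoImplicit false

namespace Summit.QuantumFields.BalabanUV.T4Continuum.NE7b.BlockAverageTowerSectionNorm

open Matrix WithLp Finset
open Literature.MathematicalPhysics.QuantumFieldTheory.Balaban1983to89
open B5Prop11Plancherel (Tor fine unitVec)
open B5Action121 (GradOp)
open B5Block118 (QsOp)
open B5RealFields (reM)
open B5Composition116 (recast)
open B5Ineq167UpperZd (gamma1)
open Summit.QuantumFields.BalabanUV.T4Continuum.NE7b.BlockAverageTower (exists_tower)
open Summit.QuantumFields.BalabanUV.T4Continuum.NE7b.BlockAverageSectionNorm
  (unitForm_symm unitForm_nonneg opNorm_le_of_sandwich section_opNorm_le)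

variable {d : ℕ}
/-! ## The recursive Gaussian tower's section letters are level-free -/

section Tower

variable (L : ℕ) [NeZero L]

/-- **THE FREE TOWER's SECTION LETTERS DO NOT SEE THE LEVEL**: for every level family `N (j+1) = fine L (N j)` (through `recast`), unit Dirichlet
forms `R j`, block averages `D j = re Q′_L`, and every `k ≥ 1`, BATW's tower `(V, H)` (re-obtained here: `V k = R k`, recursion, floor, uniqueness,
(1.67)) satisfies for every `j < k`: **`‖H j‖ ≤ (1 + 4d·gamma1 d ∕ (2∕L²))·√(L^d)`** and `‖V j‖ ≤ 4d·gamma1 d` — constants of `d` and `L` only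
(floor `2∕L²` and ceiling `gamma1 d ≥ 1` from BATW; `‖R k‖`'s bound `4d ≤ 4d·gamma1 d` at the top). [folklore] -/
theorem tower_section_opNorm_le (k : ℕ) (hk : 1 ≤ k) :
    ∀ (N : ℕ → Fin d → ℕ) [∀ j μ, NeZero (N j μ)] (e : ∀ j, fine L (N j) = N (j + 1))
      (R : ∀ j, EuclideanSpace ℝ (Tor (N j)) →L[ℝ] EuclideanSpace ℝ (Tor (N j)) →L[ℝ] ℝ)
      (D : ∀ j, EuclideanSpace ℝ (Tor (N (j + 1))) →L[ℝ] EuclideanSpace ℝ (Tor (N j))),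
      (∀ j g h, R j g h = ofLp g ⬝ᵥ (((reM (GradOp (N j) 1))ᵀ * reM (GradOp (N j) 1)) *ᵥ ofLp h)) →
      (∀ j x, ofLp (D j x) = reM (QsOp L (N j)) *ᵥ fun z => ofLp x (recast (congrFun (e j)) z)) →
      ∃ (V : ∀ j, EuclideanSpace ℝ (Tor (N j)) →L[ℝ] EuclideanSpace ℝ (Tor (N j)) →L[ℝ] ℝ)
        (H : ∀ j, EuclideanSpace ℝ (Tor (N j)) →L[ℝ] EuclideanSpace ℝ (Tor (N (j + 1)))),
        V k = R k ∧
        (∀ j, j < k → (∀ g, D j (H j g) = g) ∧ (∀ g κ, D j κ = 0 → V (j + 1) (H j g) κ = 0) ∧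
          V j = ((L : ℝ) ^ 2 / (L : ℝ) ^ d) • (V (j + 1)).bilinearComp (H j) (H j)) ∧
        (∀ j, j < k → ∀ g, R j g g ≤ V j g g ∧ V j g g ≤ gamma1 d * R j g g) ∧
        (∀ j, j < k → ‖H j‖ ≤ (1 + 4 * d * gamma1 d / (2 / (L : ℝ) ^ 2)) * Real.sqrt ((L : ℝ) ^ d)) ∧
        (∀ j, j < k → ‖V j‖ ≤ 4 * d * gamma1 d) := by
  intro N _ e R D hR hD
  obtain ⟨V, H, htop, hrec, hfloor, -, hsp, h167, -⟩ := exists_tower L k hk N e R D hR hD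
  have hγ1 : (1 : ℝ) ≤ gamma1 d := by
    rw [gamma1]
    have : (0 : ℝ) ≤ 8 * (d : ℝ) ^ 2 * 36 ^ d := by positivity
    linarith
  have hγ0 : (0 : ℝ) ≤ gamma1 d := zero_le_one.trans hγ1
  have hm : (0 : ℝ) < 2 / (L : ℝ) ^ 2 := by
    have hL : (0 : ℝ) < L := by exact_mod_cast Nat.pos_of_ne_zero (NeZero.ne L)
    positivity
  -- every level form `V (j+1)`, `j < k`, is symmetric, `≥ 0` and `≤ gamma1 d · R (j+1)`: below the top by BATW, at the top `R k` itself
  have hlev : ∀ j, j < k → (∀ g h, V (j + 1) g h = V (j + 1) h g) ∧ (∀ g, 0 ≤ V (j + 1) g g) ∧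
      (∀ g, V (j + 1) g g ≤ gamma1 d * R (j + 1) g g) := fun j hj => by
    rcases Nat.lt_or_ge (j + 1) k with hjk | hjk
    · exact ⟨(hsp (j + 1) hjk).1, (hsp (j + 1) hjk).2, fun g => (h167 (j + 1) hjk g).2⟩
    · obtain rfl : j + 1 = k := le_antisymm hj hjk
      rw [htop]
      exact ⟨unitForm_symm (hR (j + 1)), unitForm_nonneg (hR (j + 1)),
        fun g => le_mul_of_one_le_left (unitForm_nonneg (hR (j + 1)) g) hγ1⟩
  refine ⟨V, H, htop, hrec, h167, fun j hj => ?_, fun j hj => ?_⟩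
  · obtain ⟨hsy, hpo, hce⟩ := hlev j hj
    obtain ⟨hHs, hHo, -⟩ := hrec j hj
    exact section_opNorm_le L (N j) (N (j + 1)) (e j) (hR (j + 1)) hsy hpo hγ0 hce (hD j) hm (hfloor j hj) hHs hHo
  · obtain ⟨hsy, hpo⟩ := hsp j hj
    exact opNorm_le_of_sandwich (hR j) hsy hpo hγ0 fun g => (h167 j hj g).2

/-- Toy: at `d = 4`, `L = 2` the level-free section letter is `(1 + 16·gamma1 4 ∕ (1∕2))·√16 = 4 + 128·214 990 850 ≈ 2.75 × 10¹⁰` — huge, and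
the product over `k` levels is its `k`-th power: level-free factors, NOT a controlled product (the control is BATL ∕ BATW's closed form). -/
example : (1 + 4 * (4 : ℝ) * 214990850 / (2 / (2 : ℝ) ^ 2)) * 4 = 4 + 128 * 214990850 := by norm_num

end Tower

end Summit.QuantumFields.BalabanUV.T4Continuum.NE7b.BlockAverageTowerSectionNorm
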